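import Summits.QuantumAdvantage.QuantumAdvantage.Theses.LinnikCubicClassGroups
import Literature.Computability.Complexity.BoolEncodings
import HarnessLib.Audit

/-!
# Line `oriented-arakelov-fingerprint` — skeleton for crux `PureCubicClassGroupFBQP`
(stmt-QuantumAdvantage-11544, route LinnikCubicClassGroups, rank 3)

Crux (BY NAME, never restated): `Summit.QuantumAdvantage.QuantumAdvantage.Theses.LinnikCubicClassGroups.PureCubicClassGroupFBQP`
= `DegreeOnePrimesEscape → ∃ f ∈ FBQP, |f x| = 2|x|+8, f x = low bits of h(K)` for every cubic `K ∋ ∛(decodeNat x)`,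
`decodeNat x` not a cube.

## The line (idea card `Ideas/oriented-arakelov-fingerprint.md`, triage TRIAGE-r1-{1,2,3} all pass)

Label the point `(e, x, θ) ∈ ℤ^T × ℝ × ℝ` by the Gaussian/straddle FINGERPRINT state of the METRISED lattice
`flow(x, θ) · N(𝔞)^{-1/3} σ(𝔞) ⊂ ℝ × ℂ ≅ ℝ³`, `𝔞 = ∏ Pᵢ^{eᵢ}` (a canonical Lipschitz quantum state on Schoof's oriented
Arakelov class group of a signature-(1,1) field: one real flow, one angle of known period `2π`, component group `Cl(K)`).
The label is EXACTLY periodic under a full-rank lattice `Λ ⊂ ℝ^{T+2}` whose `ℤ^T`-shadow is the relation lattice of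
the classes `[Pᵢ]`, so the quantum half of the crux is ONE continuous hidden-subgroup computation (de Boer–Ducas–Fehr 2020,
EHKS 2014, Biasse–Song 2016) followed by an HNF; generation of `Cl(K)` by random large degree-one primes is the route's
hypothesis `DegreeOnePrimesEscape` (+ the counting lemma `RandomSamplesGenerate`), GRH nowhere.

## Stubs (6, registered; `sorry` lives only in `stub_*`), composition `PureCubicClassGroupFBQP_of` (pure logic)

* `stub_fingerprintSeparates` (M) — flow-orbit of the metrised lattice = ideal class (card's First lemma; TRUE per all 3 triagers).
* `stub_orientedOracle` (L, the line's number theory; uses A) — the fingerprint is a dBDF `(a, r, ε)`-HSP oracle on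
  `ℤ^T × ℝ²`: exact periodicity/injectivity modulo a full lattice `Λ`, `proj_{ℤ^T}`-shadow = relations, `λ₁(Λ) ≥ 1/4`,
  `covol(Λ) ≤ 2^{c·n_K}`, Lipschitz `a = 2^{2S+Q+c}` in `(x, θ)`, overlap `≤ 3/4` at sup-distance `≥ 1/100` from `Λ`,
  for widths `s = 2^S ≫ q = 2^Q ≫ |d_K|^c` (triage r1-2/r1-3 sharpenings: ε is NOT small for the plain fingerprint —
  `1/N𝔥` for commensurable pairs — so only `ε₀ = 3/4` is claimed here and the tensor power `F^{⊗k}` (ε ↦ ε^k) is taken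
  inside stub C; `r` absolute; `λ₁ ≥ min(1, R_K)`; `s ≥ 2^k λ₃` with `2^k ≫ √|d|` against shear near-automorphisms).
* `stub_continuousHSPCore` (XL, HARDEST) — `OracleFacts → IsQSolvable coreRel`: de Boer–Ducas–Fehr's continuous-HSP theorem
  transported to `ℤ^T × ℝ²` (Biasse–Song embedding), with the tensor-power amplification of `ε`, the preparation of
  3-dimensional lattice-Gaussian straddle states in the tree's circuit model, and dual-lattice → `Λ` → `[ℤ^T : Λ_ℤ]` (HNF)
  post-processing; output = order of the subgroup of `Cl(O_K)` generated by the given degree-one primes of `ℚ(∛(ab²))`.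
* `stub_cubicGeneration` (M) — `DegreeOnePrimesEscape → CubicGeneration`: `T ≥ T₀ (log₂ x + 1)³` uniform draws
  `(j, q) ∈ Fin 4 × [0, x]` (↦ the `j`-th prime `(q, θ − c)`, `c³ ≡ m (q)`, or the trivial class) generate `Cl(K)` except
  for a fraction `≤ 1/12`, once `x ≥ |d_K|^C` (RandomSamplesGenerate + Chebyshev `π(x) ≥ x log 2/ log x − …` + Dedekind–Kummer).
* `stub_pureCubicFacts` (M) — existence of `ℚ(∛m)`, signature `(1,1)`, integrality of `∛m`, `|d_K| ≤ 27 m²`, class number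
  depends only on `m` (the last two thirds are PROVED in the disprover's Disproof.lean v2 / NegativeLoadBearing candidate:
  `nonempty_algEquiv_adjoinRoot`, `classNumber_eq_of_cubic`).
* `stub_classicalWrap` (L) — `CoreSolvable → CubicGeneration → PureCubicFacts → (∃ f ∈ FBQP …)`: Shor-factor `m = ab²`
  (`factoring_mem_FBQP_holds`), coins for the draws, cube roots mod `q`, one call of the core, majority amplification,
  output the low `2|x|+8` bits; error budget `1/12 + 1/12 + 1/12 < 1/3` on every input (`isQSolvable_classicalWrap` pattern).

## Disproof used
`Disproof.lean` (cdisprove v2.1) is not mounted in planner jails; honoured through its evidence notes: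
`not_crux_iff` (a disproof must prove `DegreeOnePrimesEscape` AND a quantum lower bound — this line is a proof line, consistent);
the three load-bearing guards (non-cube / cube-root / degree) are kept verbatim in `CruxConclusion` and enter ONLY at
`stub_classicalWrap` + `stub_pureCubicFacts` ("the line uses the non-cube guard at stub_pureCubicFacts: signature (1,1) and
`K ≅ ℚ[X]/(X³−m)` fail for cubes"); `conclusion_iff_canonical` — every stub below speaks of `x` only through
`m = decodeNat x` and `|x|`, and of `K` only up to the data `(m; (qᵢ, cᵢ))`. No landed `Negative/` lemma exists to import.

## What is NOT claimed (costume guard)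
No stub restates the crux, the summit, the target `PureCubicClassNumberHard`, or a refuted statement (negatives index:
CubicForrelation/SeparableFrames/KummerSector/ShorLocallyDark — unrelated shapes). `stub_classicalWrap` concludes the crux's
conclusion only from the two substantive intermediate results `CoreSolvable` (a promise problem about ONE explicit
function of `(a, b, (qᵢ, cᵢ)ᵢ)`) and `CubicGeneration`.
-/

noncomputable section

set_option linter.dupNamespace false

open scoped Pointwise nonZeroDivisors NumberField
open NumberField NumberField.InfinitePlace NumberField.mixedEmbedding
open _root_.Computability Literature.Computability.Complexity Literature.Computability.Cryptography

namespace Summit.QuantumAdvantage.QuantumAdvantage.Cruxes.PureCubicClassGroupFBQP.OrientedArakelovFingerprint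

/-! ## 1. Objects: the oriented Arakelov flow, metrised ideal lattices, the fingerprint -/

section Objects

variable (K : Type*) [Field K] [NumberField K]

/-- The archimedean flow on the mixed space `ℝ^{r₁} × ℂ^{r₂}`: real coordinates are multiplied by `e^x`, complex ones by
`e^{-x/2 + iθ}`. In signature `(1,1)` this is the connected component `(ℝ_{>0} × ℂ^×)¹` of Schoof's `\widetilde{Pic}⁰_K`
acting on metrised lattices (one flow `x`, one angle `θ` of period `2π`). [Schoof 2008, arXiv:0801.3835 §5–6] -/
def flow (x θ : ℝ) (p : mixedSpace K) : mixedSpace K :=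
  (fun w => Real.exp x * p.1 w, fun w => Complex.exp (((-(x / 2) : ℝ) : ℂ) + (θ : ℂ) * Complex.I) * p.2 w)

/-- The METRISED lattice of a fractional ideal: `N(I)^{-1/3} · σ(I) ⊂ ℝ × ℂ` (covolume independent of `I`).
[EHKS 2014 §5; Schoof 2008 §4] -/
def metrisedLattice (I : (FractionalIdeal (𝓞 K)⁰ K)ˣ) : Set (mixedSpace K) :=
  ((((FractionalIdeal.absNorm (I : FractionalIdeal (𝓞 K)⁰ K)) : ℚ) : ℝ) ^ (-(1 / 3 : ℝ))) •
    ((mixedEmbedding.idealLattice K I : Submodule ℤ (mixedSpace K)) : Set (mixedSpace K))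

variable {K} in
/-- Real coordinates `(v₁, Re v₂, Im v₂) ∈ ℝ³` of a point of the mixed space at the chosen places `w₁` (real), `w₂` (complex). -/
def coords (w₁ : {w : InfinitePlace K // IsReal w}) (w₂ : {w : InfinitePlace K // IsComplex w})
    (p : mixedSpace K) : Fin 3 → ℝ :=
  ![p.1 w₁, (p.2 w₂).re, (p.2 w₂).im]

/-- `∏ᵢ Pᵢ^{eᵢ}` in the group of invertible fractional ideals (`e ∈ ℤ^T`). -/
def idealPow {T : ℕ} (P : Fin T → (FractionalIdeal (𝓞 K)⁰ K)ˣ) (e : Fin T → ℤ) :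
    (FractionalIdeal (𝓞 K)⁰ K)ˣ :=
  ∏ i, P i ^ e i

/-- The lattice `L(g) ⊂ ℝ³` labelled by the group element `g = (e, x, θ) ∈ ℤ^T × ℝ × ℝ`:
`flow(x, θ) · N(𝔞)^{-1/3} σ(𝔞)`, `𝔞 = ∏ Pᵢ^{eᵢ}`, read in the coordinates of `(w₁, w₂)`. -/
def orbitLattice {T : ℕ} (w₁ : {w : InfinitePlace K // IsReal w}) (w₂ : {w : InfinitePlace K // IsComplex w})
    (P : Fin T → (FractionalIdeal (𝓞 K)⁰ K)ˣ) (g : (Fin T → ℤ) × ℝ × ℝ) : Set (Fin 3 → ℝ) :=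
  coords w₁ w₂ '' (flow K g.2.1 g.2.2 '' metrisedLattice K (idealPow K P g.1))

end Objects

/-- The inclusion `ℤ^T × ℝ × ℝ ↪ ℝ^{T+2}` (integer coordinates first, then `x`, then `θ`). -/
def embed (T : ℕ) (g : (Fin T → ℤ) × ℝ × ℝ) : Fin (T + 2) → ℝ :=
  fun k => if h : (k : ℕ) < T then ((g.1 ⟨k, h⟩ : ℤ) : ℝ) else if (k : ℕ) = T then g.2.1 else g.2.2

/-- Gaussian weight `ρ_s(v) = exp(−π‖v‖²/s²)` on `ℝ³`. [Banaszczyk 1993; EHKS 2014 §3] -/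
def gaussWeight (s : ℝ) (v : Fin 3 → ℝ) : ℝ :=
  Real.exp (-(Real.pi * ∑ t, v t ^ 2) / s ^ 2)

/-- One-dimensional STRADDLE encoding at resolution `1/q`: the real number `t` is spread over the two neighbouring grid
points `⌊qt⌋`, `⌊qt⌋ + 1` with amplitudes `cos`, `sin` of `(π/2)·{qt}` — unit norm, `(πq/2)`-Lipschitz in `t`, orthogonal
for `|t − t'| ≥ 2/q`. [EHKS 2014 §3 (straddle encoding); de Boer–Ducas–Fehr 2020 §2] -/
def straddle (q : ℕ) (t : ℝ) (j : ℤ) : ℝ :=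
  if j = ⌊(q : ℝ) * t⌋ then Real.cos (Real.pi / 2 * Int.fract ((q : ℝ) * t))
  else if j = ⌊(q : ℝ) * t⌋ + 1 then Real.sin (Real.pi / 2 * Int.fract ((q : ℝ) * t))
  else 0

/-- Amplitude of the (unnormalised) FINGERPRINT state of a discrete set `L ⊂ ℝ³` on the grid point `j ∈ ℤ³`:
`Σ_{v ∈ L} ρ_s(v) ∏ₜ straddle_q(vₜ, jₜ)`. [EHKS 2014 §3; de Boer–Ducas–Fehr 2020 §2.4] -/
def fpAmp (s : ℝ) (q : ℕ) (L : Set (Fin 3 → ℝ)) (j : Fin 3 → ℤ) : ℝ :=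
  ∑' v : L, gaussWeight s (v : Fin 3 → ℝ) * ∏ t, straddle q ((v : Fin 3 → ℝ) t) (j t)

/-- `ℓ²(ℤ³)` inner product of two fingerprints. -/
def fpInner (s : ℝ) (q : ℕ) (L L' : Set (Fin 3 → ℝ)) : ℝ :=
  ∑' j : Fin 3 → ℤ, fpAmp s q L j * fpAmp s q L' j

/-- Overlap `⟨F(L) | F(L')⟩` of the NORMALISED fingerprint states. -/
def fpOverlap (s : ℝ) (q : ℕ) (L L' : Set (Fin 3 → ℝ)) : ℝ :=
  fpInner s q L L' / Real.sqrt (fpInner s q L L * fpInner s q L' L')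

/-- Distance `‖F(L) − F(L')‖ = √(2 − 2⟨F(L)|F(L')⟩)` of the normalised (real) fingerprint states. -/
def fpDist (s : ℝ) (q : ℕ) (L L' : Set (Fin 3 → ℝ)) : ℝ :=
  Real.sqrt (2 - 2 * fpOverlap s q L L')

/-- Bit-size parameter `n_K = ⌊log₂ |d_K|⌋ + 1` governing all polynomial bounds. -/
def bitsize (K : Type*) [Field K] [NumberField K] : ℕ :=
  Nat.log2 (NumberField.discr K).natAbs + 1

/-! ## 2. The statements of the six stubs (named `Prop`s) -/

/-- STATEMENT A (card's First lemma `FingerprintSeparatesClasses`, fractional-ideal form). In signature `(1,1)`, two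
metrised ideal lattices lie in the same flow orbit iff the ideals have the same class: (⇐) `J = γI`, flip `γ ↦ −γ` if
`σ₁γ < 0`, `e^x = (N I/N J)^{1/3} σ₁γ`, then `|e^{-x/2+iθ}|` is automatic from `|N γ| = N J / N I`; (⇒) a coordinatewise
multiplier carrying `σ(a)` to `σ(b)` is `σ(b/a)`, so `J = (b/a) I`. [Schoof 2008 Prop 6.4–6.5; triage r1-1/r1-2/r1-3: TRUE] -/
def FingerprintSeparates : Prop :=
  ∀ (K : Type) [Field K] [NumberField K], nrRealPlaces K = 1 → nrComplexPlaces K = 1 →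
    ∀ I J : (FractionalIdeal (𝓞 K)⁰ K)ˣ,
      (∃ x θ : ℝ, flow K x θ '' metrisedLattice K I = metrisedLattice K J) ↔
        ClassGroup.mk K I = ClassGroup.mk K J

/-- The `(a, r, ε)`-HSP ORACLE PROPERTY of the fingerprint of `K` at places `(w₁, w₂)`, primes `P`, width `s`, resolution
`1/q`, Lipschitz constant `a`, covolume bound `C` — de Boer–Ducas–Fehr 2020 Def. 1 on the mixed group `ℤ^T × ℝ²`
(`r = 1/100`, `ε = 3/4`, sup norm of `ℝ^{T+2}`), plus what the post-processing needs about the hidden lattice `Λ`: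
(wd) the fingerprint sums converge and the state is nonzero; (per) `L(g) = L(g') ↔ g − g' ∈ Λ` (exact periodicity AND
injectivity modulo `Λ`); (cls) `e ∈ proj_{ℤ^T} Λ ↔ ∏ [Pᵢ]^{eᵢ} = 1`; (geo) `Λ` is a full lattice with `λ₁ ≥ 1/4` and
`covol ≤ C`; (lip) `‖F(e,x,θ) − F(e,x',θ')‖ ≤ a·‖(x−x', θ−θ')‖_∞`; (sep) `|⟨F(g)|F(g')⟩| ≤ 3/4` whenever
`dist_∞(g − g', Λ) ≥ 1/100` (Euclidean `r = √2/100 < (1/4)/6` after the sup → ℓ² transport on the two continuous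
coordinates — dBDF's `r < λ₁/6`; `ε = 3/4 < 1` is all the tensor power in STUB C needs — `3/4` and not `1/2` because two DISTINCT metrised ideal lattices may share an index-2 sublattice when `K` has two primes
of norm 2, e.g. Dedekind's field of discriminant `−503`, and then the wide-Gaussian overlap is `≥ 1/2`; for pure cubic
fields the prime of norm 2 is unique and the true value is `≤ 1/3 + o(1)`, triage r1-2). -/
def OracleProperty (K : Type*) [Field K] [NumberField K]
    (w₁ : {w : InfinitePlace K // IsReal w}) (w₂ : {w : InfinitePlace K // IsComplex w})
    {T : ℕ} (P : Fin T → (FractionalIdeal (𝓞 K)⁰ K)ˣ) (s : ℝ) (q : ℕ) (a C : ℝ) : Prop :=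
  ∃ Λ : Submodule ℤ (Fin (T + 2) → ℝ), ∃ _hd : DiscreteTopology Λ, ∃ _hz : IsZLattice ℝ Λ,
    -- (wd) well-definedness of the fingerprint states
    (∀ g : (Fin T → ℤ) × ℝ × ℝ,
      (∀ j : Fin 3 → ℤ, Summable fun v : orbitLattice K w₁ w₂ P g =>
          gaussWeight s (v : Fin 3 → ℝ) * ∏ t, straddle q ((v : Fin 3 → ℝ) t) (j t)) ∧
      Summable (fun j : Fin 3 → ℤ => fpAmp s q (orbitLattice K w₁ w₂ P g) j ^ 2) ∧
      0 < fpInner s q (orbitLattice K w₁ w₂ P g) (orbitLattice K w₁ w₂ P g)) ∧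
    -- (per) exact periodicity and injectivity modulo Λ
    (∀ g g' : (Fin T → ℤ) × ℝ × ℝ,
      orbitLattice K w₁ w₂ P g = orbitLattice K w₁ w₂ P g' ↔ embed T g - embed T g' ∈ Λ) ∧
    -- (cls) the ℤ^T-shadow of Λ is the relation lattice of the classes [P i]
    (∀ e : Fin T → ℤ, (∃ x θ : ℝ, embed T (e, x, θ) ∈ Λ) ↔ ∏ i, ClassGroup.mk K (P i) ^ e i = 1) ∧
    -- (geo) first minimum and covolume of Λ
    (∀ v ∈ Λ, v ≠ 0 → (1 / 4 : ℝ) ≤ ‖v‖) ∧ ZLattice.covolume Λ ≤ C ∧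
    -- (lip) Lipschitz in the archimedean coordinates, uniformly in e
    (∀ (e : Fin T → ℤ) (x θ x' θ' : ℝ),
      fpDist s q (orbitLattice K w₁ w₂ P (e, x, θ)) (orbitLattice K w₁ w₂ P (e, x', θ'))
        ≤ a * max |x - x'| |θ - θ'|) ∧
    -- (sep) separation away from Λ
    (∀ g g' : (Fin T → ℤ) × ℝ × ℝ, (∀ v ∈ Λ, (1 / 100 : ℝ) ≤ ‖embed T g - embed T g' - v‖) →
      |fpOverlap s q (orbitLattice K w₁ w₂ P g) (orbitLattice K w₁ w₂ P g')| ≤ 3 / 4)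

/-- STATEMENT B's conclusion = C⁺ of the card, as sharpened by triage: ONE absolute exponent `c` such that for every
signature-(1,1) field, every factor base `P` and all resolutions/widths `q = 2^Q ≥ |d_K|^c`, `s = 2^S ≥ q·|d_K|^c`, the
fingerprint is an oracle in the above sense with `a = 2^{2S+Q+c}` and `covol ≤ 2^{c n_K}`. All constants have
`poly(n_K, S, Q)` bits — exactly the input the continuous-HSP theorem consumes (cost polynomial in `log a`, `log 1/r`,
`log covol`, `T`). The exponent `2S` (rather than the expected `S`: `‖∂F‖ ≲ q·E_ρ|v| ≲ qs`) leaves room for crude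
lattice-point counting in place of smoothing-parameter estimates. -/
def OracleFacts : Prop :=
  ∃ c : ℕ, ∀ (K : Type) [Field K] [NumberField K]
    (w₁ : {w : InfinitePlace K // IsReal w}) (w₂ : {w : InfinitePlace K // IsComplex w}),
    nrRealPlaces K = 1 → nrComplexPlaces K = 1 →
      ∀ (T : ℕ) (P : Fin T → (FractionalIdeal (𝓞 K)⁰ K)ˣ) (Q S : ℕ),
        c * bitsize K ≤ Q → Q + c * bitsize K ≤ S →
          OracleProperty K w₁ w₂ P (2 ^ S) (2 ^ Q) (2 ^ (2 * S + Q + c)) (2 ^ (c * bitsize K))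

/-! ### The core promise problem (input: `(a, b, [(qᵢ, cᵢ)]ᵢ)`; output: `|⟨[Pᵢ]⟩|`) -/

section Core

variable (K : Type*) [Field K] [NumberField K]

/-- The ideal `(q, θ − c)` of `O_K` attached to a descriptor `p = (q, c)` (a degree-one prime above `q` when `q ∤ 3ab` is
prime and `c³ ≡ ab² (mod q)`, by Dedekind–Kummer for `ℤ[θ] ⊂ O_K`). -/
def primeIdealOf (θ : 𝓞 K) (p : ℕ × ℕ) : Ideal (𝓞 K) :=
  Ideal.span {((p.1 : ℕ) : 𝓞 K), θ - ((p.2 : ℕ) : 𝓞 K)}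

omit [NumberField K] in
theorem natCast_mem_primeIdealOf (θ : 𝓞 K) (p : ℕ × ℕ) :
    ((p.1 : ℕ) : 𝓞 K) ∈ primeIdealOf K θ p :=
  Ideal.subset_span (by simp)

theorem primeIdealOf_ne_bot (θ : 𝓞 K) {p : ℕ × ℕ} (hp : p.1 ≠ 0) : primeIdealOf K θ p ≠ ⊥ := by
  intro h
  have hmem := natCast_mem_primeIdealOf K θ p
  rw [h, Ideal.mem_bot] at hmem
  exact hp (by exact_mod_cast hmem)

theorem primeIdealOf_mem_nonZeroDivisors (θ : 𝓞 K) {p : ℕ × ℕ} (hp : p.1 ≠ 0) :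
    primeIdealOf K θ p ∈ (Ideal (𝓞 K))⁰ :=
  mem_nonZeroDivisors_iff_ne_zero.mpr (primeIdealOf_ne_bot K θ hp)

/-- The subgroup of `Cl(O_K)` generated by the classes of the ideals `(qᵢ, θ − cᵢ)`. -/
def classSubgroup (θ : 𝓞 K) (qc : List (ℕ × ℕ))
    (h : ∀ p ∈ qc, primeIdealOf K θ p ∈ (Ideal (𝓞 K))⁰) : Subgroup (ClassGroup (𝓞 K)) :=
  Subgroup.closure {g | ∃ p, ∃ hp : p ∈ qc, g = ClassGroup.mk0 ⟨primeIdealOf K θ p, h p hp⟩}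

end Core

/-- Boolean encoding of a core instance `(a, b, [(q₁,c₁), …, (q_T,c_T)])` (tree pairing/list combinators). -/
def encodeCore (a b : ℕ) (qc : List (ℕ × ℕ)) : List Bool :=
  ((encodingNatBool.pairBool encodingNatBool).pairBool
    ((encodingNatBool.pairBool encodingNatBool).listBool)).encode ((a, b), qc)

/-- The PROMISE of a core instance: `m = ab²` with `a, b` squarefree coprime, `m ≥ 2` (so `m` is not a cube and
`K = ℚ(∛m)` is well defined with explicit integral basis, Cohen GTM 138 Thm 6.4.13), and each `(qᵢ, cᵢ)` a degree-one
prime descriptor: `qᵢ ∤ 3ab` prime, `cᵢ < qᵢ`, `cᵢ³ ≡ m (mod qᵢ)`. -/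
def CorePromise (a b : ℕ) (qc : List (ℕ × ℕ)) : Prop :=
  Squarefree a ∧ Squarefree b ∧ a.Coprime b ∧ 2 ≤ a * b ^ 2 ∧
    ∀ p ∈ qc, p.1.Prime ∧ ¬ p.1 ∣ 3 * a * b ∧ p.2 < p.1 ∧ p.2 ^ 3 % p.1 = (a * b ^ 2) % p.1

/-- The CORE search problem: on a promised instance, output (a string with prefix) `bin |⟨[P₁], …, [P_T]⟩|`, the order of
the subgroup of `Cl(O_K)` generated by the given degree-one primes of the complex cubic field `K = ℚ(∛(ab²))`
(= `[ℤ^T : Λ_ℤ]`, the index of the relation lattice). No requirement off the promise; the value does not depend on the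
admissible `(K, θ)` (all are isomorphic, `m` not a cube). -/
def coreRel (w : List Bool) : Set (List Bool) :=
  {y | ∀ (a b : ℕ) (qc : List (ℕ × ℕ)), w = encodeCore a b qc → CorePromise a b qc →
    ∀ (K : Type) [Field K] [NumberField K] (θ : 𝓞 K), Module.finrank ℚ K = 3 →
      θ ^ 3 = ((a * b ^ 2 : ℕ) : 𝓞 K) → nrRealPlaces K = 1 → nrComplexPlaces K = 1 →
        ∀ h : ∀ p ∈ qc, primeIdealOf K θ p ∈ (Ideal (𝓞 K))⁰,
          encodeNat (Nat.card (classSubgroup K θ qc h)) <+: y}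

/-- STATEMENT C's conclusion: the core problem is solvable in bounded-error quantum polynomial time (tree's strict
`IsQSolvable`: uniform oracle-free Clifford+T family, success `≥ 2/3` on every input, answer as output prefix). -/
def CoreSolvable : Prop :=
  IsQSolvable coreRel

/-! ### Generation by random large degree-one primes (the GRH-free leg, hypothesis `DegreeOnePrimesEscape`) -/

/-- The cube roots of `m` modulo `q`, listed increasingly (`≤ 3` of them for `q ∤ 3m` prime). -/
def rootsMod (m q : ℕ) : List ℕ :=
  (List.range q).filter fun c => c ^ 3 % q = m % q

section Draw

variable (K : Type*) [Field K] [NumberField K]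

/-- One DRAW of the sampler: `ω = (j, q) ∈ Fin 4 × [0, x]` ↦ the class of the `j`-th degree-one prime `(q, θ − c_j)` above
`q` if `q ∤ 3ab` is prime and `j < #roots`, else the trivial class (a dud draw). With `x + 1` a power of two a draw is a
uniformly random bit string. -/
def drawClass (θ : 𝓞 K) (a b x : ℕ) (ω : Fin 4 × Fin (x + 1)) : ClassGroup (𝓞 K) :=
  if h : (ω.2 : ℕ).Prime ∧ ¬ (ω.2 : ℕ) ∣ 3 * a * b ∧ (ω.1 : ℕ) < (rootsMod (a * b ^ 2) ω.2).length then
    ClassGroup.mk0 ⟨primeIdealOf K θ ((ω.2 : ℕ), (rootsMod (a * b ^ 2) ω.2)[(ω.1 : ℕ)]'h.2.2),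
      primeIdealOf_mem_nonZeroDivisors K θ h.1.ne_zero⟩
  else 1

end Draw

/-- STATEMENT D's conclusion. For pure cubic data `(a, b)` and `K ∋ θ`, `θ³ = ab²`: once `x ≥ |d_K|^C` and
`T ≥ T₀ (log₂ x + 1)³`, all but a fraction `≤ 1/12` of the `T`-tuples of draws generate `Cl(O_K)`. Proof route:
`DegreeOnePrimesEscape` (n = 3: no quadratic subfield) gives `≥ π(x)/8 − 3 log₂|d_K|` escaping degree-one primes for every
maximal subgroup, i.e. escape mass `δ ≥ (π(x)/9)/(4(x+1)) ≥ 1/(80 log x)` per draw (Chebyshev, Mathlib `Chebyshev.pi_ge`);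
`RandomSamplesGenerate` (route support, candidate proofs attached) with `#Sub(Cl) ≤ h^{log₂ h}` and `h ≤ x`. -/
def CubicGeneration : Prop :=
  ∃ C T₀ : ℕ, ∀ (a b : ℕ), Squarefree a → Squarefree b → a.Coprime b → 2 ≤ a * b ^ 2 →
    ∀ (K : Type) [Field K] [NumberField K] (θ : 𝓞 K), Module.finrank ℚ K = 3 →
      θ ^ 3 = ((a * b ^ 2 : ℕ) : 𝓞 K) →
        ∀ x : ℕ, (NumberField.discr K).natAbs ^ C ≤ x → ∀ T : ℕ, T₀ * (Nat.log2 x + 1) ^ 3 ≤ T →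
          (Nat.card {v : Fin T → Fin 4 × Fin (x + 1) //
              Subgroup.closure (Set.range (drawClass K θ a b x ∘ v)) ≠ ⊤} : ℝ)
            ≤ ((4 * (x + 1) : ℕ) : ℝ) ^ T / 12

/-- STATEMENT F: the elementary facts about `K = ℚ(∛m)`, `m` not a cube, that the wrapper consumes: such a cubic
number field EXISTS (`ℚ[X]/(X³ − m)`, Kummer irreducibility); it has signature `(1,1)`; a cube root of `m` is an algebraic
integer; `|d_K| ≤ |disc(X³ − m)| = 27 m²`; and the class number depends only on `m` (`K' ≅ K` for any cubic `K'` with a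
cube root of `m` — PROVED in the crux's Disproof.lean v2, `classNumber_eq_of_cubic`). The non-cube guard is load-bearing
here (Disproof: `…value_false_without_nonCube`): for a cube `m` none of this holds. -/
def PureCubicFacts : Prop :=
  ∀ m : ℕ, (∀ r : ℕ, r ^ 3 ≠ m) →
    (∃ (K : Type) (_ : Field K) (_ : NumberField K), Module.finrank ℚ K = 3 ∧ ∃ α : K, α ^ 3 = (m : K)) ∧
    ∀ (K : Type) [Field K] [NumberField K], Module.finrank ℚ K = 3 → ∀ α : K, α ^ 3 = (m : K) →
      nrRealPlaces K = 1 ∧ nrComplexPlaces K = 1 ∧ (∃ θ : 𝓞 K, (θ : K) = α) ∧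
        (NumberField.discr K).natAbs ≤ 27 * m ^ 2 ∧
        ∀ (K' : Type) [Field K'] [NumberField K'], Module.finrank ℚ K' = 3 →
          (∃ α' : K', α' ^ 3 = (m : K')) → NumberField.classNumber K' = NumberField.classNumber K

/-- The CONCLUSION of the crux, verbatim (the crux is `DegreeOnePrimesEscape → CruxConclusion`). -/
def CruxConclusion : Prop :=
  ∃ f : List Bool → List Bool, f ∈ Literature.Computability.Cryptography.FBQP ∧
    (∀ x, (f x).length = 2 * x.length + 8) ∧
    ∀ (x : List Bool) (K : Type) [Field K] [NumberField K], Module.finrank ℚ K = 3 →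
      (∀ r : ℕ, r ^ 3 ≠ Computability.decodeNat x) → (∃ α : K, α ^ 3 = (Computability.decodeNat x : K)) →
        f x = List.ofFn (fun i : Fin (2 * x.length + 8) => (NumberField.classNumber K).testBit i.val)

/-! ## 3. The registered stubs (`sorry` only here) -/

/-- STUB A (M, provable now) — `FingerprintSeparates`: flow-orbits of metrised ideal lattices are the ideal classes in
signature `(1,1)`. Leans on: `NumberField.mixedEmbedding` (ring hom, injective), `mixedEmbedding.idealLattice`,
`FractionalIdeal.absNorm`, `ClassGroup.mk_eq_mk` / `ClassGroup.mk_eq_one_iff`, `Units` of `ℝ × ℂ`. -/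
theorem stub_fingerprintSeparates : FingerprintSeparates := by
  sorry

/-- STUB B (L, the line's number theory; THE NOVEL STEP) — the oriented fingerprint is a continuous-HSP oracle:
`FingerprintSeparates → OracleFacts`. Content: (per)/(cls) from STUB A (`Λ` = stabiliser of `L(0)`; its `ℤ^T`-shadow is
the relation lattice; fibre over `e = 0` = `⟨(R_K, arg σ₂ε₀), (0, 2π)⟩`, `σ₁ε₀ > 0`); (geo) `λ₁ ≥ min(1, R_K) ≥ 1/4`
(Artin: `|d| < 4ε³ + 24` for complex cubic fields; `d = −23, −31` checked) and `covol = |⟨[Pᵢ]⟩|·2πR_K ≤ 2^{c n_K}` by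
Minkowski counting (`h ≤ |d|^{O(1)}`) and the pigeonhole unit (`R_K ≤ |d_K|^{O(1)}` — elementary, no class-number formula);
(lip) each lattice point `v` moves by `≤ |v|·|δ|`, straddle is `(πq/2)`-Lipschitz, Gaussian bulk `|v| ≲ s`; (sep) for
`g − g' ∉ Λ` the two lattices are DISTINCT of equal covolume, both `σ(O_K)`-stable and uniformly balanced
(`λ₁(L(g)) ≥ 1` from `|N α| ≥ N 𝔞`, flow-invariant, hence `λ₃ ≤ C√|d_K|` for EVERY `g` by Minkowski II): a commensurable
pair meets in `u c σ(𝔞𝔥)` with `N𝔥 ≥ 2`, overlap `= 1/N𝔥 + o(1) ≤ 1/2 + o(1)` (coset masses equidistribute once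
`s ≫ λ₃(L ∩ L')`; `N𝔥 = 2` needs two primes of norm 2 — possible, e.g. disc `−503` — hence `ε = 3/4`; pure cubic: `≤ 1/3`);
an incommensurable pair (`rank(L ∩ L') < 3`) decoheres once `s ≥ q·λ₃·|d|^{c}` and `q ≥ 2^{c}` (near-coincidences
`(A − I)v ∈ L + B(0, 2√3/q)` have density `(1/q)³/covol` unless `A` is a near-automorphism, excluded via the commutant of
`K ⊗ ℝ` for balanced lattices, triage r1-2); for `g − g' ∈ Λ + (0, δ)` with `dist_∞(δ, unit lattice) ≥ 1/100` every
`v ≠ 0` moves by `≥ |δ|·min(|v₁|, |v₂|) ≫ 1/q`. Gaussian sums by elementary counting (`#{v ∈ L : |v| ≤ R} ≤ ∏(2R/λᵢ + 1)`);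
no Poisson summation is needed at `ε = 3/4`. `λ₁(Λ) ≥ 1/4`: a vector with `e ≠ 0` has sup norm `≥ 1`; on the fibre,
`R_K = log σ₁(ε₀) ≥ log 1.3247 > 1/4` since a complex cubic unit `> 1` is a Pisot number (Siegel: the least is the plastic
number; elementary: `ε ∈ (1, 5/4]` forces `x³ − tx² + sx ∓ 1` with `|t|, |s| ≤ 3`, a finite check). Why it might need
reshaping: only through the constants (`1/4`, `1/100`, `3/4`, exponents `c`, `2S+Q+c`), all chosen with margin. -/
theorem stub_orientedOracle : FingerprintSeparates → OracleFacts := by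
  sorry

/-- STUB C (XL, HARDEST; the vendorable theorem + two bricks) — `OracleFacts → CoreSolvable`. Content:
(i) de Boer–Ducas–Fehr 2020 Thm 1 (doi:10.1007/978-3-030-45724-2_12, eprint 2019/716: an `(a, r, ε)`-HSP oracle on `ℝ^m`,
`r < λ₁/6`, `ε < 1/4`, is solved with `poly(m, log a, log 1/r, log covol, log 1/η)` qubits/queries, success `1 − η`),
transported to `ℤ^T × ℝ²` (Biasse–Song 2016 §3 embedding; here `T = O(n_K³)`), with `ε = (3/4)^k < 1/4` (`k = 5`) from
the `k`-fold TENSOR POWER of the fingerprint (`⟨ψ^{⊗k}|φ^{⊗k}⟩ = ⟨ψ|φ⟩^k`, Lipschitz `a√k`; triage r1-1/r1-2 repair)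
and Euclidean `r = √2/100 < (1/4)/6` (sup-distance `≥ 1/100` on the two continuous coordinates, integer ones differ by
`≥ 1`); (ii) preparation of the 3-dimensional lattice-Gaussian straddle state of `L(e, x, θ)` to precision
`2^{-(k' + log M)}` inside `QCircuitFamily cliffordT` (reduced basis of `∏ Pᵢ^{eᵢ}` by square-and-multiply with
re-reduction, archimedean correction tracked to `k' + log M` bits — triage r1-1; coordinatewise Grover–Rudolph since
`s ≫ λ₃`); (iii) classical post-processing: approximate dual basis → `Λ` (Buchmann–Pohst / dBDF §5) → `Λ_ℤ = proj` exact
(integer coordinates) → HNF → index `= Nat.card (classSubgroup …)` by (cls) (`ClassGroup.mk0 = ClassGroup.mk ∘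
FractionalIdeal.mk0`). No GRH anywhere: the oracle constants come from STUB B. Why it might need reshaping: dBDF list the
oracle parameters for class groups as open — here they are STUB B's output, but the `ℤ^T × ℝ²` transport is a genuine lemma. -/
theorem stub_continuousHSPCore : OracleFacts → CoreSolvable := by
  sorry

/-- STUB D (M, provable now modulo the route items) — `DegreeOnePrimesEscape → CubicGeneration`. Leans on: route item
`DegreeOnePrimesEscape` (hypothesis, n = 3, `M` maximal ⇒ `M ≠ ⊤`), route support `RandomSamplesGenerate`
(stmt-QuantumAdvantage-11545, candidate proofs attached; or `HallgrenClassGroupGeneration.card_subgroup_le` +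
union bound over coatoms), Dedekind–Kummer (`KummerDedekind`, conductor of `ℤ[θ]` divides `3ab·b`… primes `q ∤ 3ab`),
`Chebyshev.pi_ge`, `Finite.to_isCoatomic`. Degenerate cases: `h = 1` (every tuple generates), `T = 0` excluded by `T₀ ≥ 1`. -/
theorem stub_cubicGeneration :
    Summit.QuantumAdvantage.QuantumAdvantage.Theses.LinnikCubicClassGroups.DegreeOnePrimesEscape →
      CubicGeneration := by
  sorry

/-- STUB F (M, provable now) — `PureCubicFacts`. Leans on: irreducibility of `X³ − m` for non-cube `m`
(`Irreducible`, rational root theorem), `NumberField.InfinitePlace.card_real_embeddings`-type counting (one real root),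
`IsIntegral` of a root of a monic integer polynomial, `Algebra.discr` of the power basis vs `NumberField.discr`
(index formula), and the disprover's proved `classNumber_eq_of_ringEquiv` / `nonempty_ringEquiv_of_cubic`
(Disproof.lean v2; `ClassGroup.equiv`/`extendedHom`). -/
theorem stub_pureCubicFacts : PureCubicFacts := by
  sorry

/-- STUB E (L, formal plumbing; folklore) — `CoreSolvable → CubicGeneration → PureCubicFacts → CruxConclusion`.
The wrapper: `m := decodeNat x`; Shor-factor `m` (`factoring_mem_FBQP_holds`, majority-amplified to error `≤ 1/12`) and
read off `m = ab²`; if `m ∈ {0, 1}` or a cube, output `0^{2|x|+8}` (vacuous inputs); `x₀ := 2^ℓ − 1 ≥ (27m²)^C ≥ |d_K|^C`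
(STUB F), `T := T₀(ℓ+1)³`; draw `T` uniform `(j, q) ∈ Fin 4 × Fin 2^ℓ` from fresh coins, keep the valid descriptors
`(q, c_j)` (primality in `P`/AKS or Miller–Rabin inside the error budget; cube roots mod `q` by Cantor–Zassenhaus);
call the core ONCE on `encodeCore a b qc` (amplified to `≤ 1/12` by majority over repetitions — the promised output is a
function of the input); output the low `2|x|+8` bits of the returned number. Correct with probability
`≥ 1 − 3/12 ≥ 2/3` on EVERY `x`: when the kept primes generate (`CubicGeneration`, failure `≤ 1/12`) the core returns
`Nat.card ⊤ = classNumber K`, and `classNumber K' = classNumber K` for every admissible `K'` (STUB F). Model lemmas: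
`isQSolvable_classicalWrap_holds`, `IsQSolvable.mono`, sequential composition of two uniform families with coins
(as in `ShorAssembly`), `FBQP = {f | IsQSolvable (prefix f)}`. -/
theorem stub_classicalWrap : CoreSolvable → CubicGeneration → PureCubicFacts → CruxConclusion := by
  sorry

/-! ### Consistency: each named statement IS its registered stub -/

theorem fingerprintSeparates_holds : FingerprintSeparates := stub_fingerprintSeparates
theorem oracleFacts_holds : OracleFacts := stub_orientedOracle stub_fingerprintSeparates
theorem coreSolvable_holds : CoreSolvable := stub_continuousHSPCore oracleFacts_holds
theorem pureCubicFacts_holds : PureCubicFacts := stub_pureCubicFacts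

/-! ### Name-keyed aliases of the six statements (hypotheses of the composition, admissible BY NAME) -/
namespace Registered

/-- Alias of STATEMENT A keyed by the registered stub name. -/
abbrev stub_fingerprintSeparates : Prop := FingerprintSeparates
/-- Alias of STATEMENT B keyed by the registered stub name. -/
abbrev stub_orientedOracle : Prop := FingerprintSeparates → OracleFacts
/-- Alias of STATEMENT C keyed by the registered stub name. -/
abbrev stub_continuousHSPCore : Prop := OracleFacts → CoreSolvable
/-- Alias of STATEMENT D keyed by the registered stub name. -/
abbrev stub_cubicGeneration : Prop :=
  Summit.QuantumAdvantage.QuantumAdvantage.Theses.LinnikCubicClassGroups.DegreeOnePrimesEscape → CubicGeneration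
/-- Alias of STATEMENT F keyed by the registered stub name. -/
abbrev stub_pureCubicFacts : Prop := PureCubicFacts
/-- Alias of STATEMENT E keyed by the registered stub name. -/
abbrev stub_classicalWrap : Prop := CoreSolvable → CubicGeneration → PureCubicFacts → CruxConclusion

end Registered

/-! ## 4. The composition: the six stubs imply the crux, BY NAME (pure logic, no `sorry`) -/

/-- `PureCubicClassGroupFBQP` from the six stubs: given `DegreeOnePrimesEscape`, STUB D yields `CubicGeneration`; STUB B fed
with STUB A yields `OracleFacts`, which STUB C turns into `CoreSolvable`; STUB E assembles these with STUB F into the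
crux's conclusion. -/
theorem PureCubicClassGroupFBQP_of (hA : Registered.stub_fingerprintSeparates)
    (hB : Registered.stub_orientedOracle) (hC : Registered.stub_continuousHSPCore)
    (hD : Registered.stub_cubicGeneration) (hF : Registered.stub_pureCubicFacts)
    (hE : Registered.stub_classicalWrap) :
    Summit.QuantumAdvantage.QuantumAdvantage.Theses.LinnikCubicClassGroups.PureCubicClassGroupFBQP := by
  intro hEsc
  exact hE (hC (hB hA)) (hD hEsc) hF

/-- Wiring check: the registered stubs feed `PureCubicClassGroupFBQP_of` as stated. -/
example : Summit.QuantumAdvantage.QuantumAdvantage.Theses.LinnikCubicClassGroups.PureCubicClassGroupFBQP :=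
  PureCubicClassGroupFBQP_of stub_fingerprintSeparates stub_orientedOracle stub_continuousHSPCore
    stub_cubicGeneration stub_pureCubicFacts stub_classicalWrap

end Summit.QuantumAdvantage.QuantumAdvantage.Cruxes.PureCubicClassGroupFBQP.OrientedArakelovFingerprint

end
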